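import Summits.CriticalPhenomena.PercolationContinuityZ3.Theorems.Transplant.FKConnectivityAllQCountReweightedFKG
import Summits.CriticalPhenomena.PercolationContinuityZ3.Theorems.Transplant.FKConnectivityAllQClusterDom
import HarnessLib

/-!
# MM under cluster-COUNT reweightings `μ_{w,h} ∝ P_w·h(k)` — the node `ClusterDomAdjLogConvexPos` (MM for every log-convex `h`),
# the theorem for non-decreasing log-convex `h`, and the specialisation `h = q^k` (fk-1 g7's `ClusterDomAdjFKPos`)

Definitions file (`--supports stmt-CriticalPhenomena-4575`), FK sub-lane `prim-bschramm-fk-1` (gen 10) of the post-continuity programme;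
builds on p205010 (kernel theorem, internal audit signed; external expert review pending).  One definition, one `@[conjecture]` node (NOT
asserted), three theorems; no sorries; standard axioms.

FINDING OF THIS SEAT (exact census, bschramm/FROM-fk-1-g10-LEVELS.md §0 (C)): for `μ_h ∝ P_w·h(k(ω))` the master node MM of the `q < 1`
map (law of `C_x` given the pair `f = xz` open dominates its law given `f` closed) holds for EVERY LOG-CONVEX `h` tested — monotone or not,
mixture of `q^k` or not: `k!`, `2^{k²}`, `2^k + 2^{6−k}`, `(1/2)^k`, `1,1,1,2,10`, `8,4,2,2,4`, `1,2,4,12,36`, `2^k+5^k` (0 violations in 455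
instances / 7,800 levels, all up-sets, `n ≤ 6`) — and FAILS for every non-log-convex `h` tested (`h = k`: 6/55 random instances on 5–6
vertices; `k³`: 12/55; `1{k ≥ 2}`: 53/55; `1,1,4,4,4`; `1,3,9,3,1`; `10,14,17,20,22`).  Mechanism: on `{x ↮ z}` the `f`-contracted and
`f`-deleted worlds differ by the likelihood ratio `h(k−1)/h(k)`, which is non-increasing in `k` (tilting the contracted world toward FEWER
clusters, i.e. larger trees) exactly when `h` is log-convex; for `φ_{w,q}` it is the constant `q⁻¹`.  The same dichotomy governs the chain
links (GEN)/(AG-loc) (kit j128315/j128343/j128406/j128619), while Kozma–Nitzan additive gluing holds for every `h` (fk-1 g9's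
`AdditiveGluingCountPos`).  For NON-DECREASING log-convex `h` MM is a THEOREM (comparison in the parameter of `f`,
`crMeasure_real_mono_weights` of `…CountReweightedFKG`), exactly as for `q ≥ 1`.
[cite: Grimmett2006, Thm. (3.21) (p. 43); Thm. (3.8) (p. 39); §3.9 (pp. 63–65); §1.4 eq. (1.20) (p. 15)]
-/

noncomputable section

namespace Summit.CriticalPhenomena.PercolationContinuityZ3.Theorems

namespace FK

open MeasureTheory Set Literature.Probability.LatticeModels Literature.Probability.Percolation
open scoped Classical

variable {V : Type*} [Fintype V]

/-- **MM under the count weight `h` on the vertex type `V`**: for every edge-parameter vector `w`, pair `f = xz` at `x` and up-set `𝒰` of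
vertex sets, `μ_{w[f↦0],h}(C_x ∈ 𝒰) ≤ μ_{w[f↦1],h}(C_x ∈ 𝒰)` (`μ_{w,h} = crMeasure w h ∝ P_w·h(k)`).  For `h = q^k` this is fk-1 g7's
`ClusterDomAdjOn V q` (`clusterDomAdjCountOn_pow_iff`). [cite: Grimmett2006, Thm. (3.21) (p. 43); §3.9 (p. 63)] -/
def ClusterDomAdjCountOn (V : Type*) [Fintype V] (h : ℕ → ℝ) : Prop :=
  ∀ (w : Sym2 V → unitInterval) (x z : V) (𝒰 : Set (Set V)), IsUpperSet 𝒰 →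
    (crMeasure (Function.update w s(x, z) 0) h).real (clusterIn x 𝒰) ≤
      (crMeasure (Function.update w s(x, z) 1) h).real (clusterIn x 𝒰)

/-- **MM for every positive LOG-CONVEX count weight on every finite weighted graph.**  CONJECTURE-SHAPED STATEMENT, NOT asserted (census
above; false without log-convexity).  Contains `ClusterDomAdjFKPos` (`clusterDomAdjFKPos_of_logConvexPos`).
[cite: Grimmett2006, §3.9 (pp. 63–65); §1.4 eq. (1.20) (p. 15)] -/
@[conjecture] def ClusterDomAdjLogConvexPos : Prop :=
  ∀ (n : ℕ) (h : ℕ → ℝ), (∀ k, 0 < h k) → (∀ j, h (j + 1) * h (j + 1) ≤ h j * h (j + 2)) → ClusterDomAdjCountOn (Fin n) h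

/-- `h = q^k`: the count-weight MM is fk-1 g7's MM for `φ_{w,q}`. [cite: Grimmett2006, §1.4 eq. (1.20) (p. 15)] -/
theorem clusterDomAdjCountOn_pow_iff (q : ℝ) : ClusterDomAdjCountOn V (fun k => q ^ k) ↔ ClusterDomAdjOn V q := by
  unfold ClusterDomAdjCountOn ClusterDomAdjOn
  simp only [crMeasure_pow_eq_rcMeasureW]

/-- **MM is a theorem for non-decreasing log-convex `h`**: comparison in the parameter of `f` between `w[f↦0] ≤ w[f↦1]` for the
increasing event `{C_x ∈ 𝒰}` (`crMeasure_real_mono_weights`).  For `h = q^k`, `q ≥ 1`, this is `clusterDomAdjOn_of_one_le`.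
[cite: Grimmett2006, Thm. (3.21) (p. 43); Thm. (3.8) (p. 39)] -/
theorem clusterDomAdjCountOn_of_monotone {h : ℕ → ℝ} (hpos : ∀ k, 0 < h k) (hmono : Monotone h)
    (hlc : ∀ j, h (j + 1) * h (j + 1) ≤ h j * h (j + 2)) : ClusterDomAdjCountOn V h := by
  intro w x z 𝒰 h𝒰
  refine crMeasure_real_mono_weights (fun e => ?_) hpos hmono hlc (isUpperSet_clusterIn x h𝒰)
  by_cases he : e = s(x, z)
  · subst he; rw [Function.update_self, Function.update_self]; exact unitInterval.le_one _
  · rw [Function.update_of_ne he, Function.update_of_ne he]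

/-- **`ClusterDomAdjLogConvexPos → ClusterDomAdjFKPos`** (take `h = q^k`, `q > 0`, which is positive and log-convex with equality).
[cite: Grimmett2006, §3.9 (pp. 63–65)] -/
theorem clusterDomAdjFKPos_of_logConvexPos (hc : ClusterDomAdjLogConvexPos) : ClusterDomAdjFKPos := by
  intro q hq n
  have key := hc n (fun k => q ^ k) (fun k => pow_pos hq k) (fun j => by rw [← pow_add, ← pow_add]; ring_nf; exact le_rfl)
  exact (clusterDomAdjCountOn_pow_iff q).1 key

end FK

end Summit.CriticalPhenomena.PercolationContinuityZ3.Theorems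

end
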